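import Mathlib
import Literature.AlgebraicGeometry.Resolution.RegularLocalRingsQuotient
import Literature.AlgebraicGeometry.Resolution.RegularQuotientIdeal

/-!
# Proportionality of the exponents of two clean radicands

Route `RadicialJung`, crux `CleanModelsSuffice`, line `Sketch`: registered stub
`stub_exponentsProportional` (the "proportionality of exponents" behind the exceptionalisation
game). Let `(O, 𝔪)` be a regular local ring with fraction field `K` and `s₁, s₂ ∈ O` part of a
regular system of parameters (`O/(s₁, s₂)` regular of dimension `dim O - 2`). If two clean
monomials `g = u s₁^{a₁} s₂^{a₂}` and `g' = u' s₁^{a₁'} s₂^{a₂'}` (`u, u'` units, `p ∤ a₁`) satisfy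
`g' = ∑_{j<p} c_j^p g^j` in `K`, then `(a₁', a₂') ≡ j (a₁, a₂)` modulo `p` for a single `j`.

Proof (a rank-two valuation argument; no completion, no graded ring): `s₁` is a prime element of
`O` and the image `s̄₂` of `s₂` is a prime element of the domain `O/(s₁)` (Matsumura 14.2/14.3 via
`quotient_isRegularLocalRing_tfae`, `IsRegularLocalRing.prime_of_not_mem_sq`,
`not_mem_span_image_of_linearIndependent_toCotangent`). Clearing denominators,
`D^p g' = ∑ N_j^p g^j` in `O`. Writing `N_j = s₁^{e_j} N_j⁰` with `s₁ ∤ N_j⁰`, the `s₁`-orders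
`p e_j + j a₁` of the non-zero terms are pairwise distinct (they are distinct modulo `p`), so the
term of least order `j₀` dominates: `D^p g' ≡ N_{j₀}^p g^{j₀}` modulo `s₁^{m+1}`,
`m = p e_{j₀} + j₀ a₁`; hence `p d + a₁' = m` (`D = s₁^d D⁰`, `s₁ ∤ D⁰`) and, cancelling `s₁^m` and
reducing modulo `s₁`, `(D̄⁰)^p ū' s̄₂^{a₂'} = (N̄⁰)^p ū^{j₀} s̄₂^{j₀ a₂}` in `O/(s₁)`; comparing
`s̄₂`-orders gives `p d' + a₂' = p e' + j₀ a₂`.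
-/

set_option linter.dupNamespace false

open IsLocalRing
open Literature.AlgebraicGeometry.Resolution

namespace Summit.ResolutionOfSingularities.ResolutionOfSingularities.Theorems.RadicialJung.CleanModelsSuffice

/-- A prime `π` not dividing `y` and `s` does not divide `y ^ p * v * s ^ n` for a unit `v`.
[folklore] -/
theorem not_dvd_pow_mul_mul_pow {R : Type*} [CommRing R] {π y v s : R} (hπ : Prime π)
    (hy : ¬ π ∣ y) (hv : IsUnit v) (hs : ¬ π ∣ s) (p n : ℕ) : ¬ π ∣ y ^ p * v * s ^ n := by
  intro h
  rcases hπ.dvd_or_dvd h with h | h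
  · rcases hπ.dvd_or_dvd h with h | h
    · exact hy (hπ.dvd_of_dvd_pow h)
    · exact hπ.not_unit (isUnit_of_dvd_unit h hv)
  · exact hs (hπ.dvd_of_dvd_pow h)

/-- **Ultrametric comparison of `π`-orders.** In a domain, if `π` is prime, `π ∤ x`, `π ∤ y` and
`π ^ (m + 1) ∣ π ^ a x - π ^ m y`, then `a = m` and `π ∣ x - y`. [folklore] -/
theorem eq_and_dvd_sub_of_pow_succ_dvd {R : Type*} [CommRing R] [IsDomain R] {π x y : R}
    (hπ : Prime π) (hx : ¬ π ∣ x) (hy : ¬ π ∣ y) {a m : ℕ}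
    (h : π ^ (m + 1) ∣ π ^ a * x - π ^ m * y) : a = m ∧ π ∣ x - y := by
  have hπ0 : π ≠ 0 := hπ.ne_zero
  rcases lt_trichotomy a m with ham | rfl | hma
  · exfalso
    have h1 : π ^ (a + 1) ∣ π ^ a * x - π ^ m * y :=
      (pow_dvd_pow π (Nat.succ_le_succ ham.le)).trans h
    have h2 : π ^ (a + 1) ∣ π ^ m * y := (pow_dvd_pow π (Nat.succ_le_of_lt ham)).mul_right y
    have h3 : π ^ (a + 1) ∣ π ^ a * x := by simpa using h1.add h2
    rw [pow_succ, mul_dvd_mul_iff_left (pow_ne_zero a hπ0)] at h3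
    exact hx h3
  · refine ⟨rfl, ?_⟩
    rwa [← mul_sub, pow_succ, mul_dvd_mul_iff_left (pow_ne_zero a hπ0)] at h
  · exfalso
    have h1 : π ^ (m + 1) ∣ π ^ a * x := (pow_dvd_pow π (Nat.succ_le_of_lt hma)).mul_right x
    have h3 : π ^ (m + 1) ∣ π ^ m * y := by simpa using h1.sub h
    rw [pow_succ, mul_dvd_mul_iff_left (pow_ne_zero m hπ0)] at h3
    exact hy h3

/-- **Comparing `τ`-orders of two clean monomials.** In a Noetherian domain with a prime element
`τ`, an equality `x ^ p v τ ^ a = y ^ p w τ ^ b` (`x, y ≠ 0`, `v, w` units) forces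
`p d + a = p e + b` for the `τ`-orders `d, e` of `x, y`. [folklore] -/
theorem exists_mul_add_eq_of_pow_mul_eq {A : Type*} [CommRing A] [IsDomain A]
    [IsNoetherianRing A] {τ : A} (hτ : Prime τ) {x y v w : A} (hx : x ≠ 0) (hy : y ≠ 0)
    (hv : IsUnit v) (hw : IsUnit w) {p a b : ℕ}
    (h : x ^ p * v * τ ^ a = y ^ p * w * τ ^ b) : ∃ d e : ℕ, p * d + a = p * e + b := by
  obtain ⟨d, x₀, hx₀, rfl⟩ := WfDvdMonoid.max_power_factor' hx hτ.not_unit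
  obtain ⟨e, y₀, hy₀, rfl⟩ := WfDvdMonoid.max_power_factor' hy hτ.not_unit
  have h1 : ¬ τ ∣ (1 : A) := fun h1 => hτ.not_unit (isUnit_of_dvd_one h1)
  have heq : τ ^ (p * d + a) * (x₀ ^ p * v * 1 ^ 0) = τ ^ (p * e + b) * (y₀ ^ p * w * 1 ^ 0) :=
    calc τ ^ (p * d + a) * (x₀ ^ p * v * 1 ^ 0) = (τ ^ d * x₀) ^ p * v * τ ^ a := by ring
      _ = (τ ^ e * y₀) ^ p * w * τ ^ b := h
      _ = τ ^ (p * e + b) * (y₀ ^ p * w * 1 ^ 0) := by ring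
  -- uniqueness of the `τ`-order: the difference of the two sides is `0`
  exact ⟨d, e, (eq_and_dvd_sub_of_pow_succ_dvd hτ (not_dvd_pow_mul_mul_pow hτ hx₀ hv h1 p 0)
    (not_dvd_pow_mul_mul_pow hτ hy₀ hw h1 p 0) (m := p * e + b)
    (by rw [heq, sub_self]; exact dvd_zero _)).1⟩

/-- **Proportionality of exponents, ring form.** Let `R` be a Noetherian domain, `π ∈ R` a prime
element and `σ ∈ R` an element whose image in the domain `R/(π)` is prime. If
`D ^ p · u' π^{a₁'} σ^{a₂'} = ∑_{j<p} N_j ^ p (u π^{a₁} σ^{a₂}) ^ j` with `D ≠ 0`, `u, u'` units,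
`p` prime and `p ∤ a₁`, then `a₁' ≡ j a₁` and `a₂' ≡ j a₂` modulo `p` for one `j`: the `π`-orders
`p e_j + j a₁` of the non-zero terms are pairwise distinct, so the least one, at `j₀`, is the
`π`-order `p d + a₁'` of the left-hand side, and the leading coefficients modulo `π` agree, so that
their `σ̄`-orders `p d' + a₂'` and `p e' + j₀ a₂` coincide. [folklore] -/
theorem exponentsProportional_of_prime {R : Type*} [CommRing R] [IsDomain R] [IsNoetherianRing R]
    {π σ : R} (hπ : Prime π) (hσ : Prime (Ideal.Quotient.mk (Ideal.span {π}) σ))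
    {p : ℕ} (hp : p.Prime) {u u' : R} (hu : IsUnit u) (hu' : IsUnit u')
    (a₁ a₂ a₁' a₂' : ℕ) (ha₁ : ¬ p ∣ a₁) {D : R} (hD : D ≠ 0) (N : Fin p → R)
    (h : D ^ p * (u' * π ^ a₁' * σ ^ a₂') =
      ∑ j : Fin p, N j ^ p * (u * π ^ a₁ * σ ^ a₂) ^ (j : ℕ)) :
    ∃ j : ℕ, a₁' ≡ j * a₁ [MOD p] ∧ a₂' ≡ j * a₂ [MOD p] := by
  classical
  haveI : IsDomain (R ⧸ Ideal.span {π}) := (Ideal.Quotient.isDomain_iff_prime _).mpr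
    ((Ideal.span_singleton_prime hπ.ne_zero).mpr hπ)
  have hmk : ∀ x : R, Ideal.Quotient.mk (Ideal.span {π}) x = 0 ↔ π ∣ x := fun x => by
    rw [Ideal.Quotient.eq_zero_iff_mem, Ideal.mem_span_singleton]
  have hπσ : ¬ π ∣ σ := fun hd => hσ.ne_zero ((hmk σ).mpr hd)
  have hσ0 : σ ≠ 0 := fun h0 => hπσ (h0 ▸ dvd_zero π)
  -- factoring out powers of `π`
  have fac : ∀ x : R, x ≠ 0 → ∃ (n : ℕ) (y : R), ¬ π ∣ y ∧ x = π ^ n * y := fun x hx =>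
    WfDvdMonoid.max_power_factor' hx hπ.not_unit
  choose! e r hr her using fac
  have hterm : ∀ (y : R) (n j : ℕ), (π ^ n * y) ^ p * (u * π ^ a₁ * σ ^ a₂) ^ j =
      π ^ (p * n + j * a₁) * (y ^ p * u ^ j * σ ^ (j * a₂)) := by
    intro y n j
    ring
  -- some numerator is non-zero
  set J : Finset (Fin p) := Finset.univ.filter fun j => N j ≠ 0 with hJ
  have hJne : J.Nonempty := by
    by_contra hJe
    have hN0 : ∀ j, N j = 0 := by
      simpa [hJ, Finset.not_nonempty_iff_eq_empty, Finset.filter_eq_empty_iff] using hJe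
    simp only [hN0, zero_pow hp.ne_zero, zero_mul, Finset.sum_const_zero] at h
    exact mul_ne_zero (pow_ne_zero _ hD) (mul_ne_zero (mul_ne_zero hu'.ne_zero
      (pow_ne_zero _ hπ.ne_zero)) (pow_ne_zero _ hσ0)) h
  -- the `π`-orders of the terms are pairwise distinct
  obtain ⟨m, hm⟩ : ∃ m : Fin p → ℕ, ∀ j, m j = p * e (N j) + (j : ℕ) * a₁ := ⟨_, fun _ => rfl⟩
  have hm_inj : ∀ j j' : Fin p, m j = m j' → j = j' := by
    intro j j' hjj
    have h1 : (j : ℕ) * a₁ ≡ (j' : ℕ) * a₁ [MOD p] := by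
      have h2 := congrArg (· % p) hjj
      simp only [hm] at h2
      unfold Nat.ModEq
      rwa [add_comm, Nat.add_mul_mod_self_left, add_comm, Nat.add_mul_mod_self_left] at h2
    exact Fin.ext (Nat.ModEq.eq_of_lt_of_lt (Nat.ModEq.cancel_right_of_coprime
      ((Nat.Prime.coprime_iff_not_dvd hp).mpr ha₁) h1) j.isLt j'.isLt)
  -- the term of least `π`-order
  obtain ⟨j₀, hj₀J, hj₀min⟩ := Finset.exists_min_image J m hJne
  have hN₀ : N j₀ ≠ 0 := (Finset.mem_filter.mp hj₀J).2
  have hrest : π ^ (m j₀ + 1) ∣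
      ∑ j ∈ Finset.univ.erase j₀, N j ^ p * (u * π ^ a₁ * σ ^ a₂) ^ (j : ℕ) := by
    apply Finset.dvd_sum
    intro j hj
    have hjne : j ≠ j₀ := (Finset.mem_erase.mp hj).1
    by_cases hNj : N j = 0
    · simp [hNj, zero_pow hp.ne_zero]
    · have hjJ : j ∈ J := Finset.mem_filter.mpr ⟨Finset.mem_univ _, hNj⟩
      have hlt : m j₀ < m j :=
        lt_of_le_of_ne (hj₀min j hjJ) fun heq => hjne (hm_inj _ _ heq).symm
      rw [her (N j) hNj, hterm, ← hm]
      exact (pow_dvd_pow π (Nat.succ_le_of_lt hlt)).mul_right _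
  have hsum : (∑ j : Fin p, N j ^ p * (u * π ^ a₁ * σ ^ a₂) ^ (j : ℕ)) =
      N j₀ ^ p * (u * π ^ a₁ * σ ^ a₂) ^ (j₀ : ℕ) +
        ∑ j ∈ Finset.univ.erase j₀, N j ^ p * (u * π ^ a₁ * σ ^ a₂) ^ (j : ℕ) :=
    (Finset.add_sum_erase _ _ (Finset.mem_univ j₀)).symm
  -- Stage 1: compare `π`-orders
  obtain ⟨d, D₀, hD₀, rfl⟩ := WfDvdMonoid.max_power_factor' hD hπ.not_unit
  have hdvd : π ^ (m j₀ + 1) ∣ π ^ (p * d + a₁') * (D₀ ^ p * u' * σ ^ a₂') -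
      π ^ (m j₀) * (r (N j₀) ^ p * u ^ (j₀ : ℕ) * σ ^ ((j₀ : ℕ) * a₂)) := by
    have e1 : π ^ (p * d + a₁') * (D₀ ^ p * u' * σ ^ a₂') =
        (π ^ d * D₀) ^ p * (u' * π ^ a₁' * σ ^ a₂') := by ring
    have e2 : π ^ (m j₀) * (r (N j₀) ^ p * u ^ (j₀ : ℕ) * σ ^ ((j₀ : ℕ) * a₂)) =
        N j₀ ^ p * (u * π ^ a₁ * σ ^ a₂) ^ (j₀ : ℕ) := by
      rw [hm, ← hterm, ← her _ hN₀]
    rw [e1, e2, h, hsum, add_sub_cancel_left]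
    exact hrest
  obtain ⟨hexp₁, hdvd₁⟩ := eq_and_dvd_sub_of_pow_succ_dvd hπ
    (not_dvd_pow_mul_mul_pow hπ hD₀ hu' hπσ p a₂')
    (not_dvd_pow_mul_mul_pow hπ (hr _ hN₀) (hu.pow _) hπσ p _) hdvd
  -- Stage 2: reduce modulo `π` and compare `σ̄`-orders
  have hA : Ideal.Quotient.mk (Ideal.span {π}) D₀ ^ p * Ideal.Quotient.mk (Ideal.span {π}) u' *
      Ideal.Quotient.mk (Ideal.span {π}) σ ^ a₂' =
      Ideal.Quotient.mk (Ideal.span {π}) (r (N j₀)) ^ p *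
        Ideal.Quotient.mk (Ideal.span {π}) u ^ (j₀ : ℕ) *
        Ideal.Quotient.mk (Ideal.span {π}) σ ^ ((j₀ : ℕ) * a₂) := by
    have := (Ideal.Quotient.eq (I := Ideal.span {π})).mpr (Ideal.mem_span_singleton.mpr hdvd₁)
    simpa only [map_mul, map_pow] using this
  obtain ⟨d', e', hexp₂⟩ := exists_mul_add_eq_of_pow_mul_eq hσ
    (fun h0 => hD₀ ((hmk _).mp h0)) (fun h0 => hr _ hN₀ ((hmk _).mp h0))
    (hu'.map (Ideal.Quotient.mk (Ideal.span {π})))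
    ((hu.map (Ideal.Quotient.mk (Ideal.span {π}))).pow _) hA
  refine ⟨j₀, ?_, ?_⟩
  · rw [hm] at hexp₁
    unfold Nat.ModEq
    rw [← Nat.add_mul_mod_self_left a₁' p d, add_comm, hexp₁, add_comm,
      Nat.add_mul_mod_self_left]
  · unfold Nat.ModEq
    rw [← Nat.add_mul_mod_self_left a₂' p d', add_comm, hexp₂, add_comm,
      Nat.add_mul_mod_self_left]

/-- **Proportionality of the exponents of clean radicands.** Let `(O, 𝔪)` be a regular local
ring of characteristic `p` with fraction field `K`, `s₁, s₂ ∈ O` with `O/(s₁, s₂)` regular of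
dimension `dim O - 2` (so `s₁, s₂` is part of a regular system of parameters), `u, u'` units and
`p ∤ a₁`. If `u' s₁^{a₁'} s₂^{a₂'} = ∑_{j<p} c_j ^ p (u s₁^{a₁} s₂^{a₂}) ^ j` in `K`, then there is
`j` with `a₁' ≡ j a₁` and `a₂' ≡ j a₂` modulo `p`. [folklore] -/
theorem stub_exponentsProportional {O K : Type} [CommRing O] [IsRegularLocalRing O] [Field K]
    [Algebra O K] [IsFractionRing O K] (p : ℕ) (hp : p.Prime) [CharP O p] (s₁ s₂ : O)
    (hreg : IsRegularLocalRing (O ⧸ Ideal.span {s₁, s₂}))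
    (hdim : ringKrullDim (O ⧸ Ideal.span {s₁, s₂}) + 2 = ringKrullDim O) (u u' : O) (hu : IsUnit u)
    (hu' : IsUnit u') (a₁ a₂ a₁' a₂' : ℕ) (ha₁ : ¬ p ∣ a₁) (c : Fin p → K)
    (h : algebraMap O K (u' * s₁ ^ a₁' * s₂ ^ a₂') =
      ∑ j : Fin p, c j ^ p * algebraMap O K (u * s₁ ^ a₁ * s₂ ^ a₂) ^ (j : ℕ)) :
    ∃ j : ℕ, a₁' ≡ j * a₁ [MOD p] ∧ a₂' ≡ j * a₂ [MOD p] := by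
  classical
  haveI := isDomain_of_isRegularLocalRing O
  -- `(s₁, s₂)` is a proper ideal, so `s₁, s₂ ∈ 𝔪`
  haveI : Nontrivial (O ⧸ Ideal.span {s₁, s₂}) := hreg.toIsLocalRing.toNontrivial
  have hPtop : Ideal.span ({s₁, s₂} : Set O) ≠ ⊤ := Ideal.Quotient.nontrivial_iff.mp inferInstance
  have hmem : ∀ s ∈ ({s₁, s₂} : Set O), s ∈ maximalIdeal O := fun s hs =>
    (mem_maximalIdeal _).mpr fun hunit =>
      hPtop (Ideal.eq_top_of_isUnit_mem _ (Ideal.subset_span hs) hunit)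
  have hs₁m : s₁ ∈ maximalIdeal O := hmem s₁ (Set.mem_insert _ _)
  have hs₂m : s₂ ∈ maximalIdeal O := hmem s₂ (Set.mem_insert_of_mem _ rfl)
  -- `s₁ ≠ s₂` (Krull: `dim O ≤ dim O/(s₁) + 1`)
  have hne : s₁ ≠ s₂ := by
    rintro rfl
    rw [Set.pair_eq_singleton] at hreg hdim
    haveI := hreg
    obtain ⟨n, hn⟩ := exists_nat_cast_eq_ringKrullDim (R := O ⧸ Ideal.span {s₁})
    have hle := ringKrullDim_le_ringKrullDim_quotient_add_card ({s₁} : Finset O)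
      (by simpa [ringJacobson_eq_maximalIdeal] using hs₁m)
    rw [Finset.coe_singleton, Finset.card_singleton, Nat.cast_one, ← hdim, hn] at hle
    have hle' : n + 2 ≤ n + 1 := by exact_mod_cast hle
    omega
  -- Matsumura 14.2: the differentials of `s₁, s₂` are linearly independent in `𝔪/𝔪²`
  set S : Finset O := {s₁, s₂} with hS_def
  have hS : (S : Set O) = {s₁, s₂} := Finset.coe_pair
  have sub : (S : Set O) ⊆ maximalIdeal O := by
    rw [hS]
    exact fun s hs => hmem s hs
  have h3 : IsRegularLocalRing (O ⧸ Ideal.span (S : Set O)) ∧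
      ringKrullDim (O ⧸ Ideal.span (S : Set O)) + S.card = ringKrullDim O := by
    rw [hS, hS_def, Finset.card_pair hne]
    exact ⟨hreg, by exact_mod_cast hdim⟩
  have hliS := ((quotient_isRegularLocalRing_tfae O S sub).out 2 1).mp h3
  let f : Fin 2 → O := ![s₁, s₂]
  have hfS : ∀ i, f i ∈ (S : Set O) := by
    intro i
    rw [hS]
    fin_cases i
    · exact Set.mem_insert _ _
    · exact Set.mem_insert_of_mem _ rfl
  have hf : ∀ i, f i ∈ maximalIdeal O := fun i => sub (hfS i)
  have hι : Function.Injective fun i : Fin 2 => (⟨f i, hfS i⟩ : (S : Set O)) := by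
    intro i j hij
    have hij' : f i = f j := congrArg Subtype.val hij
    fin_cases i <;> fin_cases j
    · rfl
    · exact absurd hij' hne
    · exact absurd hij'.symm hne
    · rfl
  have hli : LinearIndependent (ResidueField O)
      fun i => (maximalIdeal O).toCotangent ⟨f i, hf i⟩ := by
    have := hliS.comp _ hι
    convert this using 2
    rfl
  -- `s₁` is prime in `O`, `s̄₂` is prime in `O/(s₁)`
  have hs₁sq : s₁ ∉ (maximalIdeal O) ^ 2 := fun hsq =>
    hli.ne_zero 0 ((Ideal.toCotangent_eq_zero _ _).mpr hsq)
  have hπ : Prime s₁ := IsRegularLocalRing.prime_of_not_mem_sq hs₁m hs₁sq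
  have hs₂ : s₂ ∉ Ideal.span {s₁} := by
    have := not_mem_span_image_of_linearIndependent_toCotangent f hf hli 1 {0} (by simp)
    simpa [f, Set.image_singleton] using this
  have hσ : Prime (Ideal.Quotient.mk (Ideal.span {s₁}) s₂) := by
    have h0 : Ideal.Quotient.mk (Ideal.span {s₁}) s₂ ≠ 0 :=
      fun h0 => hs₂ (Ideal.Quotient.eq_zero_iff_mem.mp h0)
    rw [← Ideal.span_singleton_prime h0]
    haveI := hreg
    haveI hP : (Ideal.span ({s₁, s₂} : Set O)).IsPrime :=
      (Ideal.Quotient.isDomain_iff_prime _).mp (isDomain_of_isRegularLocalRing _)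
    have hmap := Ideal.map_isPrime_of_surjective (f := Ideal.Quotient.mk (Ideal.span {s₁}))
      Ideal.Quotient.mk_surjective (I := Ideal.span ({s₁, s₂} : Set O))
      (by
        rw [Ideal.mk_ker]
        exact Ideal.span_mono (Set.singleton_subset_iff.mpr (Set.mem_insert _ _)))
    have hs₁0 : Ideal.Quotient.mk (Ideal.span {s₁}) s₁ = 0 :=
      Ideal.Quotient.eq_zero_iff_mem.mpr (Ideal.subset_span rfl)
    rwa [Ideal.map_span, Set.image_pair, hs₁0, Ideal.span_insert_zero] at hmap
  -- clearing denominators: `D ^ p g' = ∑ N_j ^ p g ^ j` in `O`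
  obtain ⟨D, hDN⟩ := IsLocalization.exist_integer_multiples_of_finite (nonZeroDivisors O) c
  choose N hN using hDN
  have hD : (D : O) ≠ 0 := nonZeroDivisors.coe_ne_zero D
  have key : algebraMap O K ((D : O) ^ p * (u' * s₁ ^ a₁' * s₂ ^ a₂')) =
      algebraMap O K (∑ j : Fin p, N j ^ p * (u * s₁ ^ a₁ * s₂ ^ a₂) ^ (j : ℕ)) := by
    rw [map_mul, map_pow, h, map_sum, Finset.mul_sum]
    refine Finset.sum_congr rfl fun j _ => ?_
    rw [map_mul (algebraMap O K) (N j ^ p), map_pow (algebraMap O K) (N j),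
      map_pow (algebraMap O K) _ (j : ℕ), hN j, Algebra.smul_def]
    ring
  exact exponentsProportional_of_prime hπ hσ hp hu hu' a₁ a₂ a₁' a₂' ha₁ hD N
    (IsFractionRing.injective O K key)

end Summit.ResolutionOfSingularities.ResolutionOfSingularities.Theorems.RadicialJung.CleanModelsSuffice
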